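import Mathlib
import HarnessLib
import Summits.PneNP.PneNP.Theses.CnfIdealGenLength
import Summits.PneNP.PneNP.Theorems.CnfIdealGenLengthRankCount
import Summits.PneNP.PneNP.Theorems.CnfIdealGenLengthRankStability

/-!
# Sketch (g2 of ideator seat 1) — crux-ideate round 1 for
`CnfIdealGenLength.RankDefectRepresentations` (stmt-PneNP-18923)

First lemmas of the two g2 idea cards:

* `neq-cover-primitive` — the square-zero (first-order / Ext¹) regime of the crux rewritten as the
  problem of rank-efficient primitives on the literal-rectangle cover of `NEQ_n ⊆ {0,1}^n × {0,1}^n`,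
  with the partition-of-unity (Schur-local repair) barrier `Σ rank π ≥ 2^n`.
* `finite-image-rigidity` — finite image of the involutions `1 - 2M_i` forces polynomial stability
  (character-ratio rigidity + Becker–Chapman); first lemma = the fixed-space/trace identity.

Stubs are `sorry`; only elaboration is claimed (plus the small glue theorems marked PROVED).
-/

set_option linter.dupNamespace false

namespace Summit.PneNP.PneNP.Cruxes.RankDefectRepresentations.G2

open Filter Classical
open Literature.Computability.Complexity
open Literature.Computability.MetaComplexity
open Literature.Computability.MetaComplexity.NCIPS
open Summit.PneNP.PneNP.Theses.CnfIdealGenLength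

/-! ## Common shapes -/

/-- The Boolean cube as an index type. -/
abbrev Cube (n : ℕ) := Fin n → Bool

/-- Index type of the block model: a cube point together with a coordinate of its block `K^m`. -/
abbrev BIdx (n m : ℕ) := Cube n × Fin m

/-- Evaluation of a non-commutative polynomial at a matrix tuple indexed by an arbitrary finite type. -/
noncomputable abbrev evι {K : Type} [Field K] {n : ℕ} {ι : Type} [Fintype ι] [DecidableEq ι]
    (M : Fin n → Matrix ι ι K) (g : MonoidAlgebra K (FreeMonoid (Fin n))) : Matrix ι ι K :=
  MonoidAlgebra.lift K (Matrix ι ι K) (FreeMonoid (Fin n)) (FreeMonoid.lift M) g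

/-- Restriction of a matrix to a set of positions (zero elsewhere) — a `0/1` Schur multiplier. -/
noncomputable def restrict {K : Type} [Zero K] {ι : Type} (S : Set (ι × ι)) (A : Matrix ι ι K) :
    Matrix ι ι K :=
  Matrix.of fun x y => if (x, y) ∈ S then A x y else 0

/-! ## Card `neq-cover-primitive` -/

/-- Positions whose cube points disagree in coordinate `i`: the region `R_i = {x_i ≠ y_i}`
(union of the two literal rectangles `{x_i = b} × {y_i = ¬b}`). -/
def disagree {n m : ℕ} (i : Fin n) : Set (BIdx n m × BIdx n m) := {p | p.1.1 i ≠ p.2.1 i}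

/-- Positions whose cube points agree in coordinate `i`. -/
def agree {n m : ℕ} (i : Fin n) : Set (BIdx n m × BIdx n m) := {p | p.1.1 i = p.2.1 i}

/-- A cover datum: one matrix per coordinate (only its entries on `R_i` matter). -/
abbrev CoverDatum (n m : ℕ) (K : Type) := Fin n → Matrix (BIdx n m) (BIdx n m) K

/-- Čech defect `≤ t`: pairwise differences have rank `≤ t` on the overlaps `R_i ∩ R_j`
(= the commutator-axiom ranks of the square-zero tuple, `stub_rank_comm_defect`). -/
def CoverDefectLE {n m : ℕ} {K : Type} [Field K] (θ : CoverDatum n m K) (t : ℕ) : Prop :=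
  ∀ i j, i ≠ j → (restrict (disagree i ∩ disagree j) (θ i - θ j)).rank ≤ t

/-- Distance `≤ D` to global sections: a single matrix `a` agrees with every `θ_i` on `R_i` up to
rank `D` (= coordinatewise rank distance of the square-zero tuple to the conjugates
`(1+a ε) D (1-a ε)` of the diagonal representation). -/
def CoverDistLE {n m : ℕ} {K : Type} [Field K] (θ : CoverDatum n m K) (D : ℕ) : Prop :=
  ∃ a : Matrix (BIdx n m) (BIdx n m) K, ∀ i, (restrict (disagree i) (θ i - a)).rank ≤ D

/-- `(G_n)`, polynomial form — the general cut lemma / Ext¹-stability in cover language: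
rank-`t` Čech data on the literal-rectangle cover of `NEQ_n` glue up to rank `n^c · t`. OPEN. -/
def CoverPolyStable : Prop :=
  ∃ c : ℕ, ∀ (n m : ℕ) (K : Type) [Field K] [CharZero K] (θ : CoverDatum n m K) (t : ℕ),
    CoverDefectLE θ t → CoverDistLE θ (n ^ c * t)

/-- Its negation in the crux's quantifier shape: linear (first-order) superpolynomial instability. -/
def CoverInstability : Prop :=
  ∀ c : ℕ, ∀ᶠ n : ℕ in atTop, ∃ (K : Type) (_ : Field K) (_ : CharZero K) (m t : ℕ)
    (θ : CoverDatum n m K), CoverDefectLE θ t ∧ ¬ CoverDistLE θ (n ^ c * t)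

/-- The diagonal coordinate projection `D_i` on the block space `⊕_x K^m`. -/
noncomputable def coordProj {n m : ℕ} (K : Type) [Field K] (i : Fin n) :
    Matrix (BIdx n m) (BIdx n m) K :=
  Matrix.diagonal fun p => if p.1 i then 1 else 0

/-- Square-zero (first-order) deformation of the diagonal cube representation by a 1-cochain `H`:
`E_i = [[D_i, H_i], [0, D_i]]`, i.e. `D_i ⊗ 1 + H_i ⊗ ε` over `K[ε]/ε²`. -/
noncomputable def sqZero {n m : ℕ} {K : Type} [Field K] (H : CoverDatum n m K) (i : Fin n) :
    Matrix (BIdx n m ⊕ BIdx n m) (BIdx n m ⊕ BIdx n m) K :=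
  Matrix.fromBlocks (coordProj K i) (H i) 0 (coordProj K i)

/-- Row-sign normalisation `θ_i(x,y) = s_i(x) · H_i(x,y)` with `s_i(x) = ±1` according to `x_i`
(rank-neutral on every row set; it turns coboundaries `[D_i, a]` into plain restrictions `a|_{R_i}`). -/
noncomputable def signRow {n m : ℕ} {K : Type} [Field K] (H : CoverDatum n m K) : CoverDatum n m K :=
  fun i => Matrix.of fun x y => (if x.1 i then (1 : K) else -1) * H i x y

/-- lin-RDR: the crux restricted to square-zero tuples (block size `m`, dimension `2 · 2^n · m`). -/
def LinRankDefectRepresentations : Prop :=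
  ∃ p : Polynomial ℕ, ∃ φ : (n : ℕ) → CNF (Fin n),
    (∀ n, ¬ (φ n).Satisfiable ∧ CNF.numClauses (φ n) ≤ p.eval n ∧ CNF.size (φ n) ≤ p.eval n) ∧
    ∀ c : ℕ, ∀ᶠ n in Filter.atTop, ∃ (K : Type) (_ : Field K) (_ : CharZero K) (m t : ℕ)
      (H : CoverDatum n m K),
      (∀ g : MonoidAlgebra K (FreeMonoid (Fin n)), IsAxiom g → (evι (sqZero H) g).rank ≤ t) ∧
      n ^ c * t < (evι (sqZero H) (clauseProduct K (φ n))).rank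

/-- DICTIONARY (i): the Boolean-axiom defect of the square-zero tuple at `i` has the rank of `H_i`
restricted to the agreement region `{x_i = y_i}`. (Block `(x,y)` of `E_i² - E_i` is
`(x_i + y_i - 1) H_i(x,y)` in the `ε`-corner and `0` elsewhere.) -/
theorem stub_rank_idem_defect {n m : ℕ} {K : Type} [Field K] [CharZero K]
    (H : CoverDatum n m K) (i : Fin n) :
    (evι (sqZero H) (X K i * X K i - X K i)).rank = (restrict (agree i) (H i)).rank := by
  sorry

/-- DICTIONARY (ii): the commutator-axiom defect at `(i,j)` controls `θ_i - θ_j` restricted to the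
overlap `R_i ∩ R_j` (`θ = signRow H`). Block `(x,y)` of the `ε`-corner of `[E_i,E_j]` is
`(x_i - y_i) H_j(x,y) - (x_j - y_j) H_i(x,y)`: on `R_i ∩ R_j` this is `± (θ_j - θ_i)(x,y)`, on
`R_i ∖ R_j` it is `± H_j` (an agreement part of `H_j`, rank `≤ t`), on `R_j ∖ R_i` it is `∓ H_i`; hence
the inequality (equality holds once the agreement parts have been subtracted, WLOG at cost `t`). -/
theorem stub_rank_comm_defect {n m : ℕ} {K : Type} [Field K] [CharZero K]
    (H : CoverDatum n m K) {i j : Fin n} (hij : i ≠ j) :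
    (restrict (disagree i ∩ disagree j) (signRow H i - signRow H j)).rank ≤
      (evι (sqZero H) (X K i * X K j - X K j * X K i)).rank +
        (restrict (agree i) (H i)).rank + (restrict (agree j) (H j)).rank := by
  sorry

/-- DICTIONARY (iii), linear telescoping: if the signed datum glues up to rank `D` and the agreement
parts have rank `≤ t`, the clause product at the square-zero tuple has rank `≤ size(φ) · (D + t)`
(conjugate the diagonal representation by `1 + a ε` and apply
`CnfIdealGenLength.rank_eval_clauseProduct_le_size_mul`, reindexed). -/
theorem stub_lin_telescoping {n m : ℕ} {K : Type} [Field K] [CharZero K]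
    (H : CoverDatum n m K) (φ : CNF (Fin n)) (hφ : ¬ φ.Satisfiable) {t D : ℕ}
    (hagree : ∀ i, (restrict (agree i) (H i)).rank ≤ t) (hdist : CoverDistLE (signRow H) D) :
    (evι (sqZero H) (clauseProduct K φ)).rank ≤ CNF.size φ * (D + t) := by
  sorry

/-- LIFTING: the square-zero class is a sub-class of the crux — a lin-RDR witness is an RDR witness
verbatim (reindex `BIdx ⊕ BIdx ≃ Fin (2·2^n·m)`; `Matrix.rank_reindex`). -/
theorem stub_rdr_of_lin : LinRankDefectRepresentations → RankDefectRepresentations := by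
  sorry

/-- Crude polynomial growth bound over `ℕ`: `p(n) ≤ p(1)·n^{deg p}` for `n ≥ 1` (copied from the g0
sketch, which is not an importable module). -/
theorem eval_le_eval_one_mul_pow (p : Polynomial ℕ) {n : ℕ} (hn : 1 ≤ n) :
    p.eval n ≤ p.eval 1 * n ^ p.natDegree := by
  rw [Polynomial.eval_eq_sum_range, Polynomial.eval_eq_sum_range, Finset.sum_mul]
  apply Finset.sum_le_sum
  intro i hi
  rw [one_pow, mul_one]
  exact Nat.mul_le_mul_left _ (Nat.pow_le_pow_right hn (Nat.lt_succ_iff.mp (Finset.mem_range.mp hi)))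

/-- Glue (PROVED from the dictionary stubs): lin-RDR forces linear superpolynomial instability,
i.e. a NEGATIVE answer to `(G_n)`; equivalently `CoverPolyStable` kills the whole square-zero class. -/
theorem coverInstability_of_lin (h : LinRankDefectRepresentations) : CoverInstability := by
  obtain ⟨p, φ, hφ, h⟩ := h
  intro c
  filter_upwards [h (p.natDegree + c + 2),
    Filter.eventually_ge_atTop (2 * p.eval 1 + 2)] with n hn hn1
  obtain ⟨K, _, _, m, t, H, hax, hlt⟩ := hn
  have hagree : ∀ i, (restrict (agree i) (H i)).rank ≤ t := fun i => by
    rw [← stub_rank_idem_defect H i]; exact hax _ (Or.inl ⟨i, rfl⟩)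
  refine ⟨K, inferInstance, inferInstance, m, 3 * t, signRow H, ?_, ?_⟩
  · intro i j hij
    have h1 := stub_rank_comm_defect H hij
    have h2 := hax _ (Or.inr ⟨i, j, hij, rfl⟩)
    have h3 := hagree i
    have h4 := hagree j
    omega
  · intro hdist
    have hle := stub_lin_telescoping H (φ n) (hφ n).1 hagree hdist
    have hsize : (φ n).size ≤ p.eval n := (hφ n).2.2
    have hp : p.eval n ≤ p.eval 1 * n ^ p.natDegree := eval_le_eval_one_mul_pow p (by omega)
    -- n^{deg p + c + 2} · t < size · (3 n^c t + t) ≤ p(1) n^{deg p} · 4 n^c t: impossible for n ≥ 2p(1)+2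
    have key : n ^ (p.natDegree + c + 2) * t < (φ n).size * (n ^ c * (3 * t) + t) := hlt.trans_le hle
    have h1 : (φ n).size * (n ^ c * (3 * t) + t) ≤ p.eval 1 * n ^ p.natDegree * (n ^ c * (3 * t) + t) :=
      Nat.mul_le_mul_right _ (hsize.trans hp)
    have h2 : n ^ c * (3 * t) + t ≤ 4 * (n ^ c * t) := by
      have : t ≤ n ^ c * t := Nat.le_mul_of_pos_left t (pow_pos (by omega) c)
      nlinarith
    have h3 : p.eval 1 * n ^ p.natDegree * (n ^ c * (3 * t) + t) ≤
        p.eval 1 * n ^ p.natDegree * (4 * (n ^ c * t)) := Nat.mul_le_mul_left _ h2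
    have h4 : p.eval 1 * 4 ≤ n * n := by nlinarith
    have h5 : p.eval 1 * n ^ p.natDegree * (4 * (n ^ c * t)) ≤ n ^ (p.natDegree + c + 2) * t := by
      have : p.eval 1 * n ^ p.natDegree * (4 * (n ^ c * t)) =
          (p.eval 1 * 4) * (n ^ p.natDegree * n ^ c) * t := by ring
      rw [this, show n ^ (p.natDegree + c + 2) = (n * n) * (n ^ p.natDegree * n ^ c) by ring]
      exact Nat.mul_le_mul_right _ (Nat.mul_le_mul_right _ h4)
    omega

/-- The `NEQ_n` matrix `J - I` on the cube. -/
noncomputable def neqMatrix (n : ℕ) (K : Type) [Field K] : Matrix (Cube n) (Cube n) K :=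
  Matrix.of fun x y => if x = y then 0 else 1

/-- A (weighted, `K`-valued) partition of unity of `NEQ_n` subordinate to the `2n` literal rectangles
`Q_{i,b} = {x_i = b} × {y_i = ¬ b}`: `π i b` is supported in `Q_{i,b}` and `Σ π = J - I`. Every
Schur-local repair map (separability-idempotent homotopy, ordered Reynolds averaging, greedy gluing,
the truncation in arXiv:2401.04676 Thm 5.1) is such a `π` applied blockwise. -/
def IsNeqPartitionOfUnity {n : ℕ} {K : Type} [Field K]
    (π : Fin n → Bool → Matrix (Cube n) (Cube n) K) : Prop :=
  (∀ i b x y, π i b x y ≠ 0 → x i = b ∧ y i = !b) ∧ ∑ i, ∑ b, π i b = neqMatrix n K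

/-- METHOD BARRIER (first lemma of the card, provable now): every partition of unity subordinate to
the literal-rectangle cover has total rank `≥ 2^n = rank (J - I)` — so every Schur-local repair of
first-order almost-representations loses a factor `2^n / (2n)` on some datum, which is exactly the
`2^{O(n)}` in all known stability proofs. -/
theorem stub_pu_rank_ge {n : ℕ} (hn : 1 ≤ n) {K : Type} [Field K] [CharZero K]
    (π : Fin n → Bool → Matrix (Cube n) (Cube n) K) (hπ : IsNeqPartitionOfUnity π) :
    2 ^ n ≤ ∑ i, ∑ b, (π i b).rank := by
  sorry

/-- Two-rectangle gluing is lossless (the `n = 2` case of `(G_n)`; cf. the census fact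
"n = 2 stability ≤ 2t"): PROVED shape, left as a stub here. -/
theorem stub_two_regions {m : ℕ} {K : Type} [Field K] [CharZero K] (θ : CoverDatum 2 m K) (t : ℕ)
    (h : CoverDefectLE θ t) : CoverDistLE θ t := by
  sorry

/-! ## Card `finite-image-rigidity` -/

/-- The involution tuple `u_i = 1 - 2 M_i` attached to a tuple of (exact) idempotents. -/
def invol {K : Type} [Field K] {n d : ℕ} (M : Fin n → Matrix (Fin d) (Fin d) K) (i : Fin n) :
    Matrix (Fin d) (Fin d) K :=
  1 - 2 • M i

/-- "Finite image": the involutions lie in a finite multiplicatively closed set of matrices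
(equivalently the subgroup of `GL_d(K)` they generate is finite). -/
def FiniteImage {K : Type} [Field K] {n d : ℕ} (M : Fin n → Matrix (Fin d) (Fin d) K) : Prop :=
  ∃ G : Finset (Matrix (Fin d) (Fin d) K), (∀ i, invol M i ∈ G) ∧ ∀ g ∈ G, ∀ h ∈ G, g * h ∈ G

/-- CONJECTURE `FiniteImageStable` (negation-side lever): exact idempotent tuples whose involutions
generate a finite group are polynomially rank-stable. With `WLOG exact idempotents` (Fitting, `+O(t)`)
and the telescoping bound this caps `rank P_φ(M) ≤ poly(n)·size(φ)·t` on every finite-image tuple,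
so every RDR witness has infinite image (some `u_i u_j` of infinite order: unipotent or
irrational-rotation dihedral defects). -/
def FiniteImageStable : Prop :=
  ∃ c : ℕ, ∀ (n d : ℕ) (K : Type) [Field K] [CharZero K] (M : Fin n → Matrix (Fin d) (Fin d) K)
    (t : ℕ), (∀ i, M i * M i = M i) → (∀ i j, (M i * M j - M j * M i).rank ≤ t) → FiniteImage M →
    ∃ M' : Fin n → Matrix (Fin d) (Fin d) K,
      (∀ i, M' i * M' i = M' i) ∧ (∀ i j, M' i * M' j = M' j * M' i) ∧
      ∀ i, (M i - M' i).rank ≤ n ^ c * t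

/-- First lemma (character-ratio prong): for a matrix `c` of finite order `o` over a field of
characteristic zero, `d - rank (c - 1) = dim Fix(c) = (1/o) Σ_{k<o} tr(c^k)`. Applied to
`c = (u_i u_j)²` inside an irreducible constituent `ρ` this gives
`rank(ρ(c) - 1) ≥ (dim ρ / 2) · (1 - max_k Re χ_ρ(c^k)/χ_ρ(1))`, i.e. constituents in which some
dihedral defect is non-trivial but has a character-ratio gap are SMALL (`dim ρ ≤ 2 t_ρ / gap`). -/
theorem stub_finrank_fix_eq_avg_trace {K : Type} [Field K] [CharZero K] {d o : ℕ} (ho : 0 < o)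
    (c : Matrix (Fin d) (Fin d) K) (hc : c ^ o = 1) :
    ((d : K) - ((c - 1).rank : K)) * (o : K) = ∑ k ∈ Finset.range o, (c ^ k).trace := by
  sorry

/-- Consequence shape used by the card (with `WLOG exact idempotents`): on finite-image tuples the
clause product obeys the polynomial telescoping cap, so they can never witness the crux. -/
theorem rank_clauseProduct_le_of_finiteImage (hF : FiniteImageStable) :
    ∃ c : ℕ, ∀ (n d : ℕ) (K : Type) [Field K] [CharZero K] (M : Fin n → Matrix (Fin d) (Fin d) K)
      (t : ℕ) (φ : CNF (Fin n)), ¬ φ.Satisfiable → (∀ i, M i * M i = M i) →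
      (∀ i j, (M i * M j - M j * M i).rank ≤ t) → FiniteImage M →
      (MonoidAlgebra.lift K (Matrix (Fin d) (Fin d) K) (FreeMonoid (Fin n)) (FreeMonoid.lift M)
        (clauseProduct K φ)).rank ≤ CNF.size φ * (n ^ c * t) := by
  obtain ⟨c, hc⟩ := hF
  refine ⟨c, fun n d K _ _ M t φ hφ hid hcomm hfin => ?_⟩
  obtain ⟨M', h1, h2, h3⟩ := hc n d K M t hid hcomm hfin
  exact Summit.PneNP.PneNP.Theorems.CnfIdealGenLength.rank_eval_clauseProduct_le_size_mul
    M M' h1 h2 hφ h3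

end Summit.PneNP.PneNP.Cruxes.RankDefectRepresentations.G2
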